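import Mathlib.Algebra.BigOperators.Fin
import Mathlib.Algebra.Order.BigOperators.Group.Finset
import Mathlib.Data.Fintype.BigOperators
import Mathlib.Data.Nat.Log
import Mathlib.Tactic
import HarnessLib

/-!
# Pintz–Ruzsa I, Lemma 12 (Gallagher's Lemma 5): coincidences of sums of `k` powers of `2`

Topic `Literature/NumberTheory/Sieve` (additive problems with primes and powers of `2`). Theorems
only; everything is PROVED.

For `k ≥ 2` and `L ≥ 0` let
`r_{k,k}(m) = #{(ν, μ) ∈ [1, L]^k × [1, L]^k : 2^{ν₁} + ⋯ + 2^{ν_k} - 2^{μ₁} - ⋯ - 2^{μ_k} = m}`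
(Pintz–Ruzsa, Acta Arith. 109 (2003), (9.1)). **Lemma 12** there (= Gallagher, Invent. Math. 29
(1975), Lemma 5): `r_{k,k}(0) ≤ 2 L^{2k-2}`. Printed proof: "choosing all `μᵢ` and
`ν₁, …, ν_{k-2}` arbitrarily we have at most one representation for the remaining `n` as
`2^{ν_{k-1}} + 2^{ν_k}` if `ν_{k-1} ≤ ν_k`." This is the diagonal term of the major-arc bound (10.4)
in the proof of the Goldbach–Linnik theorem (`Literature.NumberTheory.Sieve.goldbach_linnik`,
parity.S36): `r_{k,k}(0) ∫₀¹ |S|² ≤ 2L^{2k-2} · 2N/log N = o(N L^{2k}/log² N)`.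

* `two_pow_add_two_pow_inj` — `2^a + 2^b = 2^c + 2^d`, `a ≤ b`, `c ≤ d` ⇒ `(a, b) = (c, d)`;
* `PintzRuzsa2003.card_powTwoCoincidences_le` — Lemma 12, for tuples `Fin k → ℕ` with entries in
  `[1, L]` (any finite window `Finset.Icc 1 L`; the value `L = ⌊log₂ N⌋` is the application).

## References

* J. Pintz, I. Z. Ruzsa, *On Linnik's approximation to Goldbach's problem, I*, Acta Arith. 109
  (2003) 169–194, §9 (9.1) and Lemma 12. [PintzRuzsa2003]
* P. X. Gallagher, *Primes and powers of 2*, Invent. Math. 29 (1975) 125–142, Lemma 5. [Gallagher1975]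
-/

open Finset

namespace Literature.NumberTheory.Sieve

/-- **Sums of two powers of `2` determine the exponents**: if `2^a + 2^b = 2^c + 2^d` with `a ≤ b`
and `c ≤ d` then `a = c` and `b = d` (compare `2`-adic valuations, then sizes). [folklore] -/
theorem two_pow_add_two_pow_inj {a b c d : ℕ} (hab : a ≤ b) (hcd : c ≤ d)
    (h : 2 ^ a + 2 ^ b = 2 ^ c + 2 ^ d) : a = c ∧ b = d := by
  -- the smaller exponents agree
  have key : ∀ {a b c d : ℕ}, a ≤ b → c ≤ d → 2 ^ a + 2 ^ b = 2 ^ c + 2 ^ d → a ≤ c → a = c := by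
    intro a b c d hab hcd h hac
    by_contra hne
    have hac' : a + 1 ≤ c := by omega
    have hdvd : 2 ^ (a + 1) ∣ 2 ^ c + 2 ^ d :=
      dvd_add (Nat.pow_dvd_pow 2 hac') (Nat.pow_dvd_pow 2 (hac'.trans hcd))
    rw [← h] at hdvd
    rcases hab.eq_or_lt with rfl | hlt
    · -- `a = b`: `2^{a+1} = 2^c + 2^d ≥ 2^{a+1} + 2^{a+1}`
      have h1 : 2 ^ (a + 1) ≤ 2 ^ c := Nat.pow_le_pow_right (by norm_num) hac'
      have h2 : 2 ^ (a + 1) ≤ 2 ^ d := Nat.pow_le_pow_right (by norm_num) (hac'.trans hcd)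
      have h3 : 2 ^ a + 2 ^ a = 2 ^ (a + 1) := by rw [pow_succ]; ring
      have : 0 < 2 ^ (a + 1) := by positivity
      omega
    · -- `a < b`: `2^{a+1} ∣ 2^b`, hence `2^{a+1} ∣ 2^a`
      have hb : 2 ^ (a + 1) ∣ 2 ^ b := Nat.pow_dvd_pow 2 hlt
      have ha : 2 ^ (a + 1) ∣ 2 ^ a := (Nat.dvd_add_left hb).mp hdvd
      have := Nat.le_of_dvd (by positivity) ha
      have : 2 ^ a < 2 ^ (a + 1) := Nat.pow_lt_pow_right (by norm_num) (by omega)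
      omega
  have hac : a = c := by
    rcases le_total a c with hle | hle
    · exact key hab hcd h hle
    · exact (key hcd hab h.symm hle).symm
  subst hac
  refine ⟨rfl, ?_⟩
  have : 2 ^ b = 2 ^ d := by omega
  exact Nat.pow_right_injective le_rfl this

namespace PintzRuzsa2003

/-- The sum of `k` powers of `2` with exponents `ν : Fin k → ℕ`. [cite: PintzRuzsa2003, §9 (9.1)] -/
theorem sum_two_pow_fin_succ_succ {j : ℕ} (ν : Fin (j + 2) → ℕ) :
    ∑ i, 2 ^ ν i = (∑ i : Fin j, 2 ^ ν (Fin.castSucc (Fin.castSucc i))) +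
      2 ^ ν (Fin.castSucc (Fin.last j)) + 2 ^ ν (Fin.last (j + 1)) := by
  rw [Fin.sum_univ_castSucc, Fin.sum_univ_castSucc]

/-- **Pintz–Ruzsa I, Lemma 12 = Gallagher's Lemma 5**: for `k ≥ 2` the number of pairs of
`k`-tuples `(ν, μ)` of integers in `[1, L]` with `2^{ν₁} + ⋯ + 2^{ν_k} = 2^{μ₁} + ⋯ + 2^{μ_k}`, i.e.
`r_{k,k}(0)`, is at most `2 L^{2k-2}`: the map `(ν, μ) ↦ (ν₁, …, ν_{k-2}; μ; [ν_{k-1} ≤ ν_k])` is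
injective, since the remaining sum of two powers of `2` determines its exponents up to order
(`two_pow_add_two_pow_inj`). [cite: PintzRuzsa2003, §9 Lemma 12] [cite: Gallagher1975, Lemma 5] -/
theorem card_powTwoCoincidences_le (k L : ℕ) (hk : 2 ≤ k) :
    (((Fintype.piFinset fun _ : Fin k => Finset.Icc 1 L) ×ˢ
        (Fintype.piFinset fun _ : Fin k => Finset.Icc 1 L)).filter
        fun x => ∑ i, 2 ^ x.1 i = ∑ i, 2 ^ x.2 i).card ≤ 2 * L ^ (2 * k - 2) := by
  classical
  obtain ⟨j, rfl⟩ : ∃ j, k = j + 2 := ⟨k - 2, by omega⟩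
  have hexp : 2 * (j + 2) - 2 = j + (j + 2) + 0 := by omega
  -- target of the injection
  set T : Finset ((Fin j → ℕ) × (Fin (j + 2) → ℕ) × Bool) :=
    (Fintype.piFinset fun _ : Fin j => Finset.Icc 1 L) ×ˢ
      ((Fintype.piFinset fun _ : Fin (j + 2) => Finset.Icc 1 L) ×ˢ (Finset.univ : Finset Bool)) with hT
  have hTcard : T.card = 2 * L ^ (2 * (j + 2) - 2) := by
    rw [hT, Finset.card_product, Finset.card_product, Fintype.card_piFinset_const,
      Fintype.card_piFinset_const, Nat.card_Icc, Nat.add_sub_cancel, Finset.card_univ,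
      Fintype.card_bool, hexp, pow_add, pow_add]
    simp only [pow_zero, mul_one]
    ring
  -- the map
  set Φ : ((Fin (j + 2) → ℕ) × (Fin (j + 2) → ℕ)) → (Fin j → ℕ) × (Fin (j + 2) → ℕ) × Bool :=
    fun x => (fun i => x.1 (Fin.castSucc (Fin.castSucc i)), x.2,
      decide (x.1 (Fin.castSucc (Fin.last j)) ≤ x.1 (Fin.last (j + 1)))) with hΦ
  rw [← hTcard]
  refine Finset.card_le_card_of_injOn Φ (fun x hx => ?_) fun x hx y hy hxy => ?_
  · -- maps into `T`
    rw [Finset.mem_coe, Finset.mem_filter, Finset.mem_product, Fintype.mem_piFinset,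
      Fintype.mem_piFinset] at hx
    simp only [hT, hΦ, Finset.coe_product, Set.mem_prod, Finset.mem_coe, Fintype.mem_piFinset,
      Finset.mem_univ, and_true]
    exact ⟨fun i => hx.1.1 _, fun i => hx.1.2 i⟩
  · -- injective
    rw [Finset.mem_coe, Finset.mem_filter] at hx hy
    simp only [hΦ, Prod.mk.injEq] at hxy
    obtain ⟨h12, h2, hbit⟩ := hxy
    have hsumx := hx.2
    have hsumy := hy.2
    rw [sum_two_pow_fin_succ_succ, sum_two_pow_fin_succ_succ x.2] at hsumx
    rw [sum_two_pow_fin_succ_succ, sum_two_pow_fin_succ_succ y.2] at hsumy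
    -- the first `j` coordinates and `μ` agree, hence the last two powers have equal sums
    have hfirst : ∑ i : Fin j, 2 ^ x.1 (Fin.castSucc (Fin.castSucc i)) =
        ∑ i : Fin j, 2 ^ y.1 (Fin.castSucc (Fin.castSucc i)) :=
      Finset.sum_congr rfl fun i _ => by rw [congrFun h12 i]
    rw [h2] at hsumx
    set a := x.1 (Fin.castSucc (Fin.last j)) with ha
    set b := x.1 (Fin.last (j + 1)) with hb
    set c := y.1 (Fin.castSucc (Fin.last j)) with hc
    set d := y.1 (Fin.last (j + 1)) with hd
    have hpair : 2 ^ a + 2 ^ b = 2 ^ c + 2 ^ d := by omega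
    have hlast : a = c ∧ b = d := by
      by_cases hle : a ≤ b
      · have hle' : c ≤ d := by
          have : decide (a ≤ b) = decide (c ≤ d) := hbit
          rw [decide_eq_decide] at this
          exact this.mp hle
        exact two_pow_add_two_pow_inj hle hle' hpair
      · have hle' : ¬ c ≤ d := by
          have : decide (a ≤ b) = decide (c ≤ d) := hbit
          rw [decide_eq_decide] at this
          exact fun h => hle (this.mpr h)
        have h' := two_pow_add_two_pow_inj (le_of_not_ge hle) (le_of_not_ge hle')
          (by rw [add_comm, hpair, add_comm])
        exact ⟨h'.2, h'.1⟩
    -- reassemble `x.1 = y.1`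
    refine Prod.ext ?_ h2
    funext i
    rcases Fin.eq_castSucc_or_eq_last i with ⟨i', rfl⟩ | rfl
    · rcases Fin.eq_castSucc_or_eq_last i' with ⟨i'', rfl⟩ | rfl
      · exact congrFun h12 i''
      · exact hlast.1
    · exact hlast.2

end PintzRuzsa2003

end Literature.NumberTheory.Sieve
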